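import Literature.AlgebraicGeometry.Frobenioids.PerfectionEndomorphismTransport
import HarnessLib

/-!
# Frobenioids I, §5: transfer of `O^▷(A^pf)` along a co-angular pre-step (Definition 1.3 (iii)(c) at every level)

Mochizuki, *The geometry of Frobenioids I: the general theory*, Kyushu J. Math. **62** (2008)
293–400, Definition 1.3 (iii)(c) p. 24 ("Given any co-angular pre-step `φ : A → B`, there exists a
[uniquely determined] bijection of monoids `O^▷(A) ⥲ O^▷(B)` such that `α ↦ β` implies `β ∘ φ = φ ∘ α`"),
Proposition 1.10 (i) p. 34 (Frobenius conjugates) and Proposition 5.5 (i) p. 104, proof p. 104 l. 48 –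
p. 105 l. 1 ("the case of arbitrary `A` then follows by considering 'pairs of pre-steps' as in Theorem 5.1,
(i) [cf. also Definition 1.3, (iii), (c)]") [cite: MochizukiFrdI2008, Prop. 5.5 (i) p.104].

Sub-node FrdI:Prop5.5(i)/P55-L02 of the cell's SUBDAG-FrdI-Thm51iv-Prop55, the transfer step, for THE
perfection (`Perfection*.lean`).  For a co-angular pre-step `φ : B → A` of a Frobenioid:

* its Prop. 1.10 (i) conjugates `φ^{(c)} : B^{(c)} → A^{(c)}` along the chosen Frobenius powers are co-angular
  pre-steps (`isCoAngularPreStep_conjAt`), natural in the level (`frobTrans_conjAt`);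
* Def. 1.3 (iii)(c) applied to each `φ^{(c)}` gives isomorphisms `O^▷(B^{(c)}) ⥲ O^▷(A^{(c)})`
  (`coAngEquiv`), characterised by `φ^{(c)} ∘ e(β) = β ∘ φ^{(c)}` (uniqueness by total epimorphicity,
  `coAngEquiv_unique`) and therefore compatible with the transport between levels (`coAngEquiv_liftEnd`);
* passing to the inductive limit (`colimEquiv`, `PerfectionEndomorphismTransport.lean`):
  `endTransfer φ : O^▷((B, 1)) ⥲ O^▷((A, 1))` in `C^pf`, which on the image of `C → C^pf` is the
  Def. 1.3 (iii)(c) bijection of `φ` itself (`endTransfer_toPfEnd`).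
Only `hF : IsFrobenioid F` is assumed.
-/

namespace Literature.AlgebraicGeometry.Frobenioids

namespace PreFrobenioid

namespace Perfection

open CategoryTheory Opposite

universe w v v' u u'

variable {D : Type u} [Category.{v} D] {Φ : Dᵒᵖ ⥤ CommMonCat.{w}}
  {C : Type u'} [Category.{v'} C] {F : C ⥤ ElemFrobenioid Φ} (hF : IsFrobenioid F) {B A : C} (φ : B ⟶ A)

/-! ### The Frobenius conjugates of an arrow at every level -/

/-- `φ^{(c)} : B^{(c)} → A^{(c)}`, the Prop. 1.10 (i) conjugate of `φ : B → A` along the chosen Frobenius-type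
arrows of degree `c`. [cite: MochizukiFrdI2008, Prop. 1.10 (i) p.34] -/
noncomputable def conjAt (c : ℕ+) : frobPow hF B c ⟶ frobPow hF A c :=
  conjFr hF φ (isFrobeniusType_frob hF B c) (isFrobeniusType_frob hF A c)
    ((degFr_frob hF B c).trans (degFr_frob hF A c).symm)

/-- The defining square: `frob_B ≫ φ^{(c)} = φ ≫ frob_A`. [cite: MochizukiFrdI2008, Prop. 1.10 (i) p.34] -/
theorem frob_conjAt (c : ℕ+) : frob hF B c ≫ conjAt hF φ c = φ ≫ frob hF A c :=
  conjFr_spec hF φ _ _ _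

/-- At level `1` the conjugate is the representative of `toPf(φ)`. [cite: MochizukiFrdI2008, Def. 3.1 (iii) p.57] -/
theorem conjAt_one : conjAt hF φ 1 = (toPfRep hF φ).hom := rfl

/-- `φ^{(c)}` is an epimorphism (`C` is totally epimorphic). [cite: MochizukiFrdI2008, Def. 1.3 p.24] -/
theorem epi_conjAt (c : ℕ+) : Epi (conjAt hF φ c) := hF.isPreFrobenioid.isTotallyEpimorphic.epi _

/-- The conjugates are natural in the level: `frobTrans_B ≫ φ^{(c')} = φ^{(c)} ≫ frobTrans_A`.
[cite: MochizukiFrdI2008, Prop. 1.10 (i) p.34] -/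
theorem frobTrans_conjAt {c c' : ℕ+} (h : c ∣ c') :
    frobTrans hF B h ≫ conjAt hF φ c' = conjAt hF φ c ≫ frobTrans hF A h := by
  haveI := epi_frob hF B c
  rw [← cancel_epi (frob hF B c), ← Category.assoc, frob_frobTrans, frob_conjAt, ← Category.assoc,
    frob_conjAt, Category.assoc, frob_frobTrans]

/-- If `φ` is a co-angular pre-step then so is each `φ^{(c)}` (Prop. 1.10 (i)).
[cite: MochizukiFrdI2008, Prop. 1.10 (i) p.34] -/
theorem isCoAngularPreStep_conjAt (hφ : IsCoAngularPreStep F φ) (c : ℕ+) :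
    IsCoAngularPreStep F (conjAt hF φ c) :=
  ⟨hφ.1.frobeniusConjugate hF (frob_conjAt hF φ c) (isFrobeniusType_frob hF B c) (isFrobeniusType_frob hF A c)
      ((degFr_frob hF B c).trans (degFr_frob hF A c).symm),
    hφ.2.frobeniusConjugate hF (frob_conjAt hF φ c) (isFrobeniusType_frob hF B c) (isFrobeniusType_frob hF A c)
      ((degFr_frob hF B c).trans (degFr_frob hF A c).symm)⟩

variable (hφ : IsCoAngularPreStep F φ)

/-! ### Definition 1.3 (iii)(c) at every level -/

/-- The Def. 1.3 (iii)(c) bijection of monoids `O^▷(B^{(c)}) ⥲ O^▷(A^{(c)})` along the co-angular pre-step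
`φ^{(c)}`. [cite: MochizukiFrdI2008, Def. 1.3 (iii)(c) p.24] -/
noncomputable def coAngEquiv (c : ℕ+) :
    endSubmonoid F (frobPow hF B c) ≃* endSubmonoid F (frobPow hF A c) :=
  (hF.iii_c (conjAt hF φ c) (isCoAngularPreStep_conjAt hF φ hφ c)).choose

/-- The defining relation: `φ^{(c)} ≫ e(β) = β ≫ φ^{(c)}`. [cite: MochizukiFrdI2008, Def. 1.3 (iii)(c) p.24] -/
theorem conjAt_coAngEquiv (c : ℕ+) (β : endSubmonoid F (frobPow hF B c)) :
    conjAt hF φ c ≫ End.asHom (coAngEquiv hF φ hφ c β).1 = End.asHom β.1 ≫ conjAt hF φ c :=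
  (hF.iii_c (conjAt hF φ c) (isCoAngularPreStep_conjAt hF φ hφ c)).choose_spec β

/-- Uniqueness: `e(β)` is the only endomorphism with `φ^{(c)} ≫ γ = β ≫ φ^{(c)}` (`φ^{(c)}` is an epimorphism).
[cite: MochizukiFrdI2008, Def. 1.3 (iii)(c) p.24] -/
theorem coAngEquiv_unique (c : ℕ+) (β : endSubmonoid F (frobPow hF B c)) (γ : endSubmonoid F (frobPow hF A c))
    (h : conjAt hF φ c ≫ End.asHom γ.1 = End.asHom β.1 ≫ conjAt hF φ c) : γ = coAngEquiv hF φ hφ c β := by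
  apply Subtype.ext
  haveI := epi_conjAt hF φ c
  exact (cancel_epi (conjAt hF φ c)).mp (h.trans (conjAt_coAngEquiv hF φ hφ c β).symm)

/-- The level bijections are compatible with the transport between levels.
[cite: MochizukiFrdI2008, Prop. 1.10 (i) p.34] -/
theorem coAngEquiv_liftEnd {c c' : ℕ+} (h : c ∣ c') (β : endSubmonoid F (frobPow hF B c)) :
    coAngEquiv hF φ hφ c' (liftEnd (root hF B 1) h β) = liftEnd (root hF A 1) h (coAngEquiv hF φ hφ c β) := by
  symm
  apply coAngEquiv_unique
  haveI := hF.isPreFrobenioid.isTotallyEpimorphic.epi (frobTrans hF B h)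
  rw [← cancel_epi (frobTrans hF B h)]
  change frobTrans hF B h ≫ conjAt hF φ c' ≫ liftLevel hF (End.asHom (coAngEquiv hF φ hφ c β).1) h h rfl =
    frobTrans hF B h ≫ liftLevel hF (End.asHom β.1) h h rfl ≫ conjAt hF φ c'
  rw [← Category.assoc, frobTrans_conjAt, Category.assoc, liftLevel_spec, ← Category.assoc, conjAt_coAngEquiv,
    Category.assoc, ← frobTrans_conjAt, ← Category.assoc, ← liftLevel_spec, Category.assoc]

/-! ### The transfer `O^▷((B, 1)) ⥲ O^▷((A, 1))` -/

/-- **Transfer of `O^▷` along a co-angular pre-step, in `C^pf`**: the isomorphism of monoids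
`O^▷((B, 1)) ⥲ O^▷((A, 1))` induced on the inductive limits by the Def. 1.3 (iii)(c) bijections of the
conjugates `φ^{(c)}`. [cite: MochizukiFrdI2008, Prop. 5.5 (i) p.104] -/
noncomputable def endTransfer : (ops hF).endSubmonoid (root hF B 1) ≃* (ops hF).endSubmonoid (root hF A 1) :=
  colimEquiv (X := root hF B 1) (Y := root hF A 1) (coAngEquiv hF φ hφ)
    (fun h β => coAngEquiv_liftEnd hF φ hφ h β)

/-- `endTransfer [β] = [e(β)]` at every level. [cite: MochizukiFrdI2008, Prop. 5.5 (i) p.104] -/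
theorem endTransfer_class (c : ℕ+) (β : endSubmonoid F (frobPow hF B c)) :
    endTransfer hF φ hφ (endSubmonoidClassHom (root hF B 1) c β) =
      endSubmonoidClassHom (root hF A 1) c (coAngEquiv hF φ hφ c β) :=
  colimEquiv_class (X := root hF B 1) (Y := root hF A 1) (coAngEquiv hF φ hφ)
    (fun h β => coAngEquiv_liftEnd hF φ hφ h β) c β

/-- `(endTransfer)⁻¹ [γ] = [e⁻¹(γ)]` at every level. [cite: MochizukiFrdI2008, Prop. 5.5 (i) p.104] -/
theorem endTransfer_symm_class (c : ℕ+) (γ : endSubmonoid F (frobPow hF A c)) :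
    (endTransfer hF φ hφ).symm (endSubmonoidClassHom (root hF A 1) c γ) =
      endSubmonoidClassHom (root hF B 1) c ((coAngEquiv hF φ hφ c).symm γ) :=
  colimEquiv_symm_class (X := root hF B 1) (Y := root hF A 1) (coAngEquiv hF φ hφ)
    (fun h β => coAngEquiv_liftEnd hF φ hφ h β) c γ

/-! ### Compatibility with `C → C^pf` -/

/-- The image under `C → C^pf` of `β ∈ O^▷(B)` lies in `O^▷((B, 1))`. [cite: MochizukiFrdI2008, Prop. 3.2 (i) p.58] -/
theorem toPf_map_mem {B : C} (β : endSubmonoid F B) :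
    End.of ((toPf hF).map (End.asHom β.1)) ∈ (ops hF).endSubmonoid (root hF B 1) := by
  refine ⟨?_, ?_⟩
  · change Hom.baseMap ((toPf hF).map (End.asHom β.1)) = 𝟙 _
    rw [baseMap_toPf]
    exact β.2.1
  · change Hom.degFr ((toPf hF).map (End.asHom β.1)) = 1
    rw [degFr_toPf]
    exact β.2.2

/-- The element of `O^▷((B, 1))` determined by `β ∈ O^▷(B)` via `C → C^pf`.
[cite: MochizukiFrdI2008, Prop. 5.5 (i) p.104] -/
noncomputable def toPfEnd {B : C} (β : endSubmonoid F B) : (ops hF).endSubmonoid (root hF B 1) :=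
  ⟨End.of ((toPf hF).map (End.asHom β.1)), toPf_map_mem hF β⟩

/-- The underlying arrow of `toPfEnd β` is `toPf(β)`. [cite: MochizukiFrdI2008, Prop. 5.5 (i) p.104] -/
theorem toPfEnd_coe {B : C} (β : endSubmonoid F B) :
    (toPfEnd hF β).1 = End.of ((toPf hF).map (End.asHom β.1)) := rfl

/-- The representative of `toPf(β)` at level `1` lies in `O^▷(B^{(1)})`.
[cite: MochizukiFrdI2008, Prop. 3.2 (i) p.58] -/
theorem toPfRep_hom_mem {B : C} (β : endSubmonoid F B) :
    End.of (toPfRep hF (End.asHom β.1)).hom ∈ endSubmonoid F (frobPow hF B 1) :=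
  (endClassHom_mem_iff (root hF B 1) 1 _).mp (toPf_map_mem hF β)

/-- `toPfEnd β` is the class at level `1` of the representative of `toPf(β)`.
[cite: MochizukiFrdI2008, Def. 3.1 (iii) p.57] -/
theorem toPfEnd_eq_class {B : C} (β : endSubmonoid F B) :
    toPfEnd hF β = endSubmonoidClassHom (root hF B 1) 1 ⟨_, toPfRep_hom_mem hF β⟩ := rfl

/-- `toPfEnd` is multiplicative (`C → C^pf` is a functor). [cite: MochizukiFrdI2008, Def. 3.1 (iii) p.57] -/
theorem toPfEnd_mul {B : C} (β β' : endSubmonoid F B) :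
    toPfEnd hF (β * β') = toPfEnd hF β * toPfEnd hF β' := by
  apply Subtype.ext
  change (toPf hF).map (End.asHom β'.1 ≫ End.asHom β.1) =
    (toPf hF).map (End.asHom β'.1) ≫ (toPf hF).map (End.asHom β.1)
  exact (toPf hF).map_comp _ _

/-- `toPfEnd 1 = 1`. [cite: MochizukiFrdI2008, Def. 3.1 (iii) p.57] -/
theorem toPfEnd_one {B : C} : toPfEnd hF (1 : endSubmonoid F B) = 1 := by
  apply Subtype.ext
  change (toPf hF).map (𝟙 B) = 𝟙 _
  exact (toPf hF).map_id _

/-- The level-`1` representatives compose: `(f ≫ g)~ = f~ ≫ g~` (Prop. 1.10 (i) conjugates of a composite).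
[cite: MochizukiFrdI2008, Prop. 1.10 (i) p.34] -/
theorem toPfRep_hom_comp {X Y Z : C} (f : X ⟶ Y) (g : Y ⟶ Z) :
    (toPfRep hF (f ≫ g)).hom = (toPfRep hF f).hom ≫ (toPfRep hF g).hom :=
  conjFr_comp (hF := hF) f g (isFrobeniusType_frob hF X 1) (isFrobeniusType_frob hF Y 1) (isFrobeniusType_frob hF Z 1)
    ((degFr_frob hF X 1).trans (degFr_frob hF Y 1).symm) ((degFr_frob hF Y 1).trans (degFr_frob hF Z 1).symm)

/-- **Compatibility with `C → C^pf`**: on the image of `O^▷(B)` the transfer is the Def. 1.3 (iii)(c) bijection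
of `φ` itself — for ANY `e₀ : O^▷(B) ⥲ O^▷(A)` with `φ ≫ e₀(β) = β ≫ φ`, `endTransfer (toPf β) = toPf (e₀ β)`.
[cite: MochizukiFrdI2008, Prop. 5.5 (i) p.104] -/
theorem endTransfer_toPfEnd (e₀ : endSubmonoid F B ≃* endSubmonoid F A)
    (he₀ : ∀ β : endSubmonoid F B, φ ≫ End.asHom (e₀ β).1 = End.asHom β.1 ≫ φ) (β : endSubmonoid F B) :
    endTransfer hF φ hφ (toPfEnd hF β) = toPfEnd hF (e₀ β) := by
  rw [toPfEnd_eq_class, toPfEnd_eq_class, endTransfer_class]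
  congr 1
  symm
  apply coAngEquiv_unique
  change conjAt hF φ 1 ≫ (toPfRep hF (End.asHom (e₀ β).1)).hom = (toPfRep hF (End.asHom β.1)).hom ≫ conjAt hF φ 1
  rw [conjAt_one, ← toPfRep_hom_comp, ← toPfRep_hom_comp, he₀ β]

end Perfection

end PreFrobenioid

end Literature.AlgebraicGeometry.Frobenioids
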